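import Literature.AlgebraicGeometry.Resolution.SandwichedWeakPatching
import Literature.AlgebraicGeometry.Resolution.ProperModelsExtension
import HarnessLib

/-!
# `Pialt` (crux stmt-ResolutionOfSingularities-0555), line `SketchIdeator2` / Card A:
# weak resolution is Zariski-local modulo two-model patching and Nagata

Helper file for the stub `stub_radicialPatching` of the lead's skeleton
`radicially-regular-endgame` (STUB-PLAN `Cruxes/Pialt/STUB-PLAN-stub_radicialPatching.md`,
helpers H5-aux and H5; `--supports stmt-ResolutionOfSingularities-0555`, does not close the item).

* `exists_hom_forall_regLe` — **the multi-model patch** (Zariski 1944, Fundamental Theorem;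
  Piltant 2013, Cor. 5.7, in Piltant's `RegLe` form): from the two-model step
  "`∀ M₁ M₂, ∃ N → M₁, N → M₂` both with `φ⁻¹(Reg) ⊆ Reg`" one gets, for a proper model `M₀` and a
  finite list of proper models, ONE proper model `N → M₀` (`RegLe`) dominating every member of
  the list by a `RegLe` morphism (list induction, `Hom.RegLe.comp`).
* `hasResolution_of_forall_exists_open_hasResolution` — **WEAK RESOLUTION IS ZARISKI-LOCAL,
  modulo `ProperModel.TwoModelPatching p` and `NagataCompactification`**: an integral separated
  scheme `V` of finite type over a field of characteristic `p`, every point of which has an open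
  neighbourhood admitting a resolution of singularities, admits a resolution of singularities.
  Proof (pointwise `RegLe`, no valuations, no gluing — the pattern of
  `sandwichedWeakResolution_of_twoModelPatching`): take a finite subcover `U₁, …, Uₙ` with
  resolutions `πᵢ : Rᵢ → Uᵢ`; compactify `V ⊆ V̄` (`exists_integral_compactification`) to a proper
  model `P` of `K = K(V)` (`ProperModel.ofChart` on an affine chart `Spec A`, `K = Frac A`);
  extend each `Rᵢ → Uᵢ ≅ s(Uᵢ) ⊆ V̄` to a proper model `Pᵢ → P` with `Rᵢ = Pᵢ ×_P s(Uᵢ)`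
  (`ProperModel.exists_extension_of_nagata`); patch `P, P₁, …, Pₙ` to `N` with `ψ : N → P` and
  `χᵢ : N → Pᵢ` all `RegLe` (`exists_hom_forall_regLe`); the resolution of `V` is `ψ` restricted
  over `V`: a point `y` of `N` over `v ∈ Uᵢ` is mapped by `χᵢ` into `Pᵢ ×_P s(Uᵢ) = Rᵢ`
  (uniqueness of domination `ProperModel.Hom.f_eq`: `χᵢ ≫ φᵢ = ψ`), a regular scheme, so `y` is
  regular by `RegLe` of `χᵢ`.

Sources: O. Zariski, Ann. of Math. 45 (1944), Fundamental Theorem p. 539; O. Piltant, RACSAM 107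
(2013), Prop. 5.1 (`P = P_reg`) and Cor. 5.7; B. Conrad, J. Ramanujan Math. Soc. 22 (2007),
Thm. 4.1 (Nagata); O. Zariski, P. Samuel, *Commutative Algebra* II, Ch. VI §17.
-/

set_option linter.dupNamespace false -- mandated namespace of this single-conjunct summit

noncomputable section

open CategoryTheory CategoryTheory.Limits AlgebraicGeometry TopologicalSpace
open Literature.AlgebraicGeometry.Resolution
open Literature.AlgebraicGeometry.Morphisms (NagataCompactification)

namespace Summit.ResolutionOfSingularities.ResolutionOfSingularities.Theorems.Pialt.RadiciallyRegular


/-- **Zariski's patching of finitely many proper models, `RegLe` form** (Zariski 1944,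
Fundamental Theorem; Piltant 2013, Cor. 5.7: "by applying `n − 1` consecutive times
proposition 5.1"): if any two proper models of `K/k` are dominated by a common proper model
through morphisms `φ` with `φ⁻¹(Reg) ⊆ Reg` (`ProperModel.Hom.RegLe`), then for every proper
model `M₀` and every finite list `l` of proper models there is a proper model `N` with a `RegLe`
morphism `N → M₀` and a `RegLe` morphism `N → M` onto every member `M` of `l`. -/
theorem exists_hom_forall_regLe {k K : Type} [Field k] [Field K] [Algebra k K]
    (hZ : ∀ M₁ M₂ : ProperModel k K,
      ∃ (N : ProperModel k K) (φ₁ : N.Hom M₁) (φ₂ : N.Hom M₂), φ₁.RegLe ∧ φ₂.RegLe)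
    (M₀ : ProperModel k K) (l : List (ProperModel k K)) :
    ∃ (N : ProperModel k K) (ψ : N.Hom M₀), ψ.RegLe ∧
      ∀ M ∈ l, ∃ χ : N.Hom M, χ.RegLe := by
  induction l with
  | nil =>
    exact ⟨M₀, ProperModel.Hom.id M₀, ProperModel.Hom.RegLe.id M₀, fun M hM => by simp at hM⟩
  | cons M l ih =>
    obtain ⟨N, ψ, hψ, hN⟩ := ih
    obtain ⟨N', φ₁, φ₂, h₁, h₂⟩ := hZ N M
    refine ⟨N', φ₁.comp ψ, h₁.comp hψ, fun M' hM' => ?_⟩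
    rcases List.mem_cons.mp hM' with rfl | hl
    · exact ⟨φ₂, h₂⟩
    · obtain ⟨χ, hχ⟩ := hN M' hl
      exact ⟨φ₁.comp χ, h₁.comp hχ⟩

set_option maxHeartbeats 1600000 in
-- the proper-model bookkeeping (`ProperModel.ofChart`, restrictions) is heavy, as in the template
/-- **Weak resolution is Zariski-local, modulo two-model patching of proper models and Nagata
compactification.** Let `k` be a field of characteristic `p` and assume
`ProperModel.TwoModelPatching p` (Piltant 2013, Prop. 5.1 with `P = P_reg`, for proper models)
and `NagataCompactification`. If `V` is an integral separated `k`-scheme of finite type every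
point of which has an open neighbourhood admitting a resolution of singularities, then `V` admits
a resolution of singularities: patch a compactification `P ⊇ V` with the proper models
`Pᵢ → P` extending finitely many local resolutions `Rᵢ → Uᵢ` (`Rᵢ = Pᵢ ×_P Uᵢ`), and restrict
the patch `N → P` over `V`; over `Uᵢ` the projection `N → Pᵢ` (`= N → P` followed back, by
uniqueness of domination) lands in the regular `Rᵢ`, so `N|_V` is regular by `RegLe`. -/
theorem hasResolution_of_forall_exists_open_hasResolution {p : ℕ}
    (hNag : NagataCompactification.{0}) (hT : ProperModel.TwoModelPatching.{0} p)
    (k : Type) [Field k] [CharP k p] (V : Scheme.{0}) [IsIntegral V] (f : V ⟶ Spec (.of k))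
    [IsSeparated f] [LocallyOfFiniteType f] [QuasiCompact f]
    (hloc : ∀ v : V, ∃ U : V.Opens, v ∈ U ∧ Scheme.HasResolution (U : Scheme.{0})) :
    Scheme.HasResolution V := by
  classical
  /- Step 1: a finite subcover by resolvable opens `U v`, `v ∈ t`. -/
  choose U hU hres using hloc
  haveI : CompactSpace V := QuasiCompact.compactSpace_of_compactSpace f
  obtain ⟨t, ht⟩ := isCompact_univ.elim_finite_subcover (fun v : V => ((U v : V.Opens) : Set V))
    (fun v => (U v).2) (fun v _ => Set.mem_iUnion.mpr ⟨v, hU v⟩)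
  /- Step 2: an affine chart `Spec A` of `V`, `K := Frac A`. -/
  obtain ⟨_, ⟨W', hW, rfl⟩, hξW, -⟩ :=
    V.isBasis_affineOpens.exists_subset_of_mem_open (Set.mem_univ (genericPoint V)) isOpen_univ
  let W : V.Opens := W'
  haveI : IsAffine W := hW
  haveI : Nonempty W := ⟨⟨_, hξW⟩⟩
  let A : Type := Γ(W, ⊤)
  let gW : (W : Scheme.{0}) ⟶ Spec (.of k) := W.ι ≫ f
  let ψk : k →+* A := gW.appTop.hom.comp (Scheme.ΓSpecIso (.of k)).inv.hom
  have hψk : ψk.FiniteType := by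
    have h1 : gW.appTop.hom.FiniteType :=
      (HasRingHomProperty.iff_of_isAffine (P := @LocallyOfFiniteType)).mp inferInstance
    exact h1.comp (RingHom.FiniteType.of_surjective _
      (Scheme.ΓSpecIso (.of k)).symm.commRingCatIsoToRingEquiv.surjective)
  letI : Algebra k A := ψk.toAlgebra
  haveI hft : Algebra.FiniteType k A := hψk
  let K : Type := FractionRing A
  haveI : Algebra.EssFiniteType k K := inferInstance
  obtain ⟨jV, hjVdef⟩ : ∃ jV : Spec (.of A) ⟶ V, jV = W.toScheme.isoSpec.inv ≫ W.ι := ⟨_, rfl⟩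
  haveI : IsOpenImmersion jV := by rw [hjVdef]; infer_instance
  have hjV : jV ≫ f = Spec.map (CommRingCat.ofHom (algebraMap k A)) := by
    rw [hjVdef, Category.assoc, isoSpec_inv_comp]
    rfl
  /- Step 3: an integral proper compactification `sV : V ↪ Vb`, a proper model `P` of `K`. -/
  obtain ⟨Vb, sV, πV, hVb, hsV, hπV, hsVπ⟩ := exists_integral_compactification hNag V f
  haveI := hVb; haveI := hsV; haveI := hπV
  have hc : (jV ≫ sV) ≫ πV = Spec.map (CommRingCat.ofHom (algebraMap k A)) := by
    rw [Category.assoc, hsVπ, hjV]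
  let P : ProperModel k K := ProperModel.ofChart Vb πV A (jV ≫ sV) hc
  /- Step 4: local resolutions `π v : R v → U v`, extended to proper models `P' v → P` with
  `R v = P' v ×_P sV(U v)`. -/
  have hres' : ∀ v : V, ∃ (R : Scheme.{0}) (π : R ⟶ (U v : Scheme.{0})), IsResolution π := hres
  choose R π hπ using hres'
  have hext : ∀ v : V, ∃ (P' : ProperModel k K) (φ : P'.Hom P) (s : R v ⟶ P'.X),
      IsOpenImmersion s ∧ IsPullback s (π v ≫ (sV.isoImage (U v)).hom) φ.f (sV ''ᵁ U v).ι := by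
    intro v
    haveI := (hπ v).isProper
    haveI : IsReduced (R v) := (hπ v).isRegular.isReduced
    haveI : Nonempty ((U v : V.Opens) : Scheme.{0}) := ⟨⟨v, hU v⟩⟩
    haveI : IsIntegral ((U v : V.Opens) : Scheme.{0}) := isIntegral_of_isOpenImmersion (U v).ι
    haveI : IsIntegral (R v) := (hπ v).isBirational.isIntegral
    haveI : IsProper (π v ≫ (sV.isoImage (U v)).hom) := inferInstance
    exact ProperModel.exists_extension_of_nagata hNag P (sV ''ᵁ U v) (R v)
      (π v ≫ (sV.isoImage (U v)).hom) ((hπ v).isBirational.comp_iso _)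
  choose P' φ s hs hsq using hext
  /- Step 5: patch `P` with the `P' v`, `v ∈ t`. -/
  obtain ⟨N, ψ, -, hχ⟩ := exists_hom_forall_regLe (hT k K) P (t.toList.map P')
  /- Step 6: the resolution of `V` is `ψ` restricted over `V ≅ sV(V)`. -/
  let ρ : ((ψ.f ⁻¹ᵁ sV.opensRange : N.X.Opens) : Scheme.{0}) ⟶ V :=
    (ψ.f ∣_ sV.opensRange) ≫ sV.isoOpensRange.inv
  refine ⟨_, ρ, ⟨inferInstance, (ψ.isBirational.morphismRestrict sV.opensRange).comp_iso _, ?_⟩⟩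
  intro y
  rw [SandwichedGluing.mem_regularLocus_opens_iff]
  obtain ⟨x, hx⟩ : ∃ x : V, sV x = ψ.f y.1 := y.2
  -- `x ∈ U v` for some `v ∈ t`
  obtain ⟨v, hvt, hxv⟩ := Set.mem_iUnion₂.mp (ht (Set.mem_univ x))
  obtain ⟨χ, hχreg⟩ := hχ (P' v) (List.mem_map.mpr ⟨v, Finset.mem_toList.mpr hvt, rfl⟩)
  -- uniqueness of domination: `χ ≫ φ v = ψ`, so `φ v (χ y) = ψ y = sV x ∈ sV(U v)`
  have hfeq : (χ.comp (φ v)).f = ψ.f := ProperModel.Hom.f_eq _ _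
  have h1 : (φ v).f (χ.f y.1) = sV x := by
    have e1 : (χ.f ≫ (φ v).f) y.1 = ψ.f y.1 := by rw [← ProperModel.Hom.comp_f, hfeq]
    rw [Scheme.Hom.comp_apply] at e1
    rw [e1]
    exact hx.symm
  have h2 : (φ v).f (χ.f y.1) ∈ (sV ''ᵁ U v : Vb.Opens) := by
    rw [h1]
    exact ⟨x, hxv, rfl⟩
  -- hence `χ y` lies in `R v = P' v ×_P sV(U v)`
  obtain ⟨r, hr⟩ : ∃ r : R v, s v r = χ.f y.1 := by
    have h3 : χ.f y.1 ∈ (φ v).f.base ⁻¹' Set.range (sV ''ᵁ U v).ι.base := by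
      rw [Scheme.Opens.range_ι]
      exact h2
    rw [← Scheme.Pullback.range_fst (φ v).f (sV ''ᵁ U v).ι, ← (hsq v).isoPullback_inv_fst,
      Scheme.Hom.comp_base, TopCat.coe_comp, Set.range_comp] at h3
    obtain ⟨_, ⟨w, rfl⟩, hw⟩ := h3
    exact ⟨_, hw⟩
  -- `R v` is regular and `s v` is an open immersion, so `χ y` is a regular point; conclude by `RegLe`
  refine hχreg y.1 ?_
  rw [← hr]
  haveI := (hπ v).isRegular r
  haveI := hs v
  exact IsRegularLocalRing.of_ringEquiv (asIso ((s v).stalkMap r)).commRingCatIsoToRingEquiv.symm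

end Summit.ResolutionOfSingularities.ResolutionOfSingularities.Theorems.Pialt.RadiciallyRegular

end
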